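import Literature.Claims.NS.Polihronov2025
import HarnessLib

/-!
# C36 `Polihronov2025` — refuter's kill file (D-0090 NS-CLAIMS; refuter of record ns-claims-refuter-4)

J. Polihronov, *Well-posed Self-Similarity in Incompressible Standard Flows*, arXiv:2504.21000 **v4**
(bib `Polihronov2025SelfSimilar`); skeleton `Literature.Claims.NS.Polihronov2025` (typist-1 g2,
p479069). Filed UNCHANGED by the salvage prover under the cell's convention (b).

Kernel faces of the first failing step in print order = Theorem 3.1 proof, bullet 3 «A priori norm
estimates» p.5 (= Thm A.1 proof p.8 l.29–32, Thm B.1 proof p.10, Cor B.2 p.10–11): «Lemma 1.1 … shows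
that for β_x/β_t > 3/2, none of these norms grows with the scaling parameter, yielding uniform bounds
for all t».

* `not_UniformBoundsAbs` — the inference at its abstract grain (`UniformBoundsAbs`, cell
  TYPING-HYGIENE 13) is FALSE: `r = β_x/β_t = 2`, vorticity exponent `e = 2r − 3 = 1`, time profile
  `n(t) = t` obeys Lemma 1.1's `k`-law (as every profile does, `memberProfile_apply_scaled`) and is
  unbounded on `[0,∞)`. (Proof text = typist-1 g2's kill candidate `claims/Polihronov2025/
  SoloRefutePolihronov2025-typist1-KILLCANDIDATE.lean` 7ef6c07eabd97646, adopted verbatim.)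
* `uniformBoundsAbs_fails_for_every_weight` — the same failure for EVERY admissible isobaric weight
  `r > 3/2` and EACH of the three exponents (vorticity, velocity, energy): the «selection of the
  isobaric weight» is irrelevant to the inference.
* `memberNorm_grows_with_k` — read literally, the sub-sentence «none of these norms grows with the
  scaling parameter» is false as well: with `e > 0` the `k`-th member's norm at corresponding times,
  `k^e · n(t)`, is STRICTLY INCREASING in `k` wherever `n(t) > 0`.
* `isEmbedded_every` — the rider «embedded as the k = 1 member of a self-similar family with
  β_x/β_t > 3/2» holds for EVERY field `u : ℝ → ℝ³ → ℝ³` (Step 1 is true by unfolding), so it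
  separates no solution from any other: the consumed form `UniformBounds` (clause (i)) says that every
  classical finite-energy solution from decaying data has bounded velocity and vorticity on every
  `[0,T)` — the regularity problem itself (not attacked here).
* `lemma11_holds`, `lemma12_holds` — Steps 3 and 1 are TRUE (arithmetic / unfolding).

WHAT THIS IS NOT: not a claim about NS regularity or blow-up; not a claim about any author beyond the
typed locator.
-/

set_option linter.dupNamespace false

namespace Summit.NavierStokesRegularity.NavierStokesRegularity.Theorems.Polihronov2025

open Set Literature.Claims.NS.Polihronov2025

/-- **¬ Step 4 (abstract grain).** The printed inference «k-exponent of the norm positive (Lemma 1.1)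
⇒ the norm is bounded uniformly in t» fails for the profile `n(t) = t` with `r = 2`, `e = 2r − 3 = 1`.
[cite: Polihronov2025SelfSimilar, Thm 3.1 proof bullet 3 p.5; Thm A.1 proof p.8 l.29–32] -/
theorem not_UniformBoundsAbs : ¬ UniformBoundsAbs := by
  intro h
  have hr : (3 : ℝ) / 2 < 2 := by norm_num
  have hn : ∀ t : ℝ, 0 ≤ t → 0 ≤ (fun s : ℝ => s) t := fun t ht => ht
  obtain ⟨M, hM⟩ := h 2 hr (fun s => s) hn (2 * 2 - 3) (Or.inl rfl)
    (fun k t hk _ => memberProfile_apply_scaled _ _ hk t)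
  have := hM (max M 0 + 1) (by positivity)
  linarith [le_max_left M 0]

/-- The inference of bullet 3 fails for EVERY admissible isobaric weight `r = β_x/β_t > 3/2` and EACH
of the three `k`-exponents of Lemma 1.1 (vorticity `2r − 3`, velocity `2(r − 1)`, energy `4r − 1`):
the non-negative profile `n(t) = t` obeys the `k`-law and is unbounded. The selection of the isobaric
weight plays no role. [cite: Polihronov2025SelfSimilar, Thm 3.1 proof bullet 3 p.5; Lemma 1.1 p.3; App. F p.17] -/
theorem uniformBoundsAbs_fails_for_every_weight (r : ℝ) (_hr : 3 / 2 < r) (e : ℝ)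
    (_he : e = 2 * r - 3 ∨ e = 2 * (r - 1) ∨ e = 4 * r - 1) :
    ∃ n : ℝ → ℝ, (∀ t : ℝ, 0 ≤ t → 0 ≤ n t) ∧
      (∀ k t : ℝ, 0 < k → 0 ≤ t → memberProfile e n k (k ^ 2 * t) = k ^ e * n t) ∧
      ¬ ∃ M : ℝ, ∀ t : ℝ, 0 ≤ t → n t ≤ M := by
  refine ⟨fun s => s, fun t ht => ht, fun k t hk _ => memberProfile_apply_scaled _ _ hk t, ?_⟩
  rintro ⟨M, hM⟩
  have := hM (max M 0 + 1) (by positivity)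
  linarith [le_max_left M 0]

/-- Read literally, «for β_x/β_t > 3/2, none of these norms grows with the scaling parameter» is false
too: when the exponent `e` is positive (Lemma 1.1's conclusion) the `k`-th member's norm at
corresponding times, `memberProfile e n k (k²t) = k^e · n(t)`, is strictly increasing in the scaling
parameter `k ∈ (0,∞)` at every time where `n(t) > 0`. [cite: Polihronov2025SelfSimilar, Lemma 1.1 p.3; Thm 3.1 proof bullet 3 p.5] -/
theorem memberNorm_grows_with_k {e : ℝ} (he : 0 < e) (n : ℝ → ℝ) {t : ℝ} (ht : 0 < n t) :
    StrictMonoOn (fun k : ℝ => memberProfile e n k (k ^ 2 * t)) (Ioi 0) := by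
  intro k hk l hl hkl
  have hk' : (0 : ℝ) < k := hk
  have hl' : (0 : ℝ) < l := hl
  simp only [memberProfile_apply_scaled _ _ hk', memberProfile_apply_scaled _ _ hl']
  exact mul_lt_mul_of_pos_right (Real.rpow_lt_rpow hk'.le hkl he) ht

/-- The rider «embedded as the k = 1 member of a self-similar family (1.4) with β_x/β_t > 3/2» holds
for EVERY field (take `r = 2`): it selects nothing. [cite: Polihronov2025SelfSimilar, Lemma 1.2 p.3; Cor 1.3 p.4; Thm 3.1 proof bullet 1 p.5] -/
theorem isEmbedded_every (u : ℝ → E3 → E3) : IsEmbedded u :=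
  ⟨2, by norm_num, ssFamily_one _ u⟩

/-- Step 3 (Lemma 1.1 as printed: exponent positivity) holds. [cite: Polihronov2025SelfSimilar, Lemma 1.1 p.3] -/
theorem lemma11_holds : Lemma11 := fun r hr => ⟨by linarith, by linarith, by linarith⟩

/-- Step 1 (Lemma 1.2 / Cor 1.3: embedding at the identity scale) holds — for every isobaric exponent.
[cite: Polihronov2025SelfSimilar, Lemma 1.2 p.3; Cor 1.3 p.4] -/
theorem lemma12_holds : Lemma12 := fun γ v => ssFamily_one γ v

end Summit.NavierStokesRegularity.NavierStokesRegularity.Theorems.Polihronov2025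

-- WHAT THIS IS NOT: not a claim about NS regularity or blow-up; not a claim about any author beyond the
-- typed locator.
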